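import Literature.NumberTheory.Automorphic.HyperspecialUnitarySatakeIntegralSymmetry
import Literature.NumberTheory.Automorphic.UnitaryRankOneSatakeClassical
import HarnessLib

/-!
# The modulus index of the SPLIT ORTHOGONAL GROUP `O_N(J₀) = U(id, J₀)` evaluated for every `N`:
# `[K_P : K_P ∩ t_μK_Pt_μ⁻¹] = q^{∑_{i<j, i<j'} (μ_i-μ_j)⁺}` (the antidiagonal root positions contribute nothing), the
# counting duality with `q` explicit, and the `w₀`-symmetry of the orthogonally normalised Satake transform
# (Laumon (4.1.3)–(4.1.4); Cartier §IV (4.2), Thm. 4.1; Satake 1963 §§8–9; Macdonald V (2.6)–(2.7))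

Topic `NumberTheory/Automorphic`; namespace `Literature.NumberTheory.Automorphic.HermitianLattice[.UnramifiedLocalConjDatum]`
(lane `lit-hodgefound`, Track 2 foundations; seat `lit-hodgefound-p11`, generation 47, row g47-#5).  THEOREMS ONLY: no
definition, no named fact, no instance, no notation.  Sequel of `UnitaryBorelModulusIndex` (g47-#2),
`HyperspecialUnitarySatakeClassicalSymmetry` (g47-#3) and `HyperspecialUnitarySatakeIntegralSymmetry` (g47-#4), which evaluate
the modulus of the Borel subgroup of `U(σ, J₀)` and draw the `w₀`-symmetry of its Satake transforms UNDER THE HYPOTHESIS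
`σ ≠ id` (`hσ : ∃ x, σ x ≠ x`), and of `SplitOrthogonalUnramifiedDatum` (g38-#6: for `σ = id` the datum
`UnramifiedLocalConjDatum (RingHom.id K) ϖ` is the split orthogonal group `O_N(J₀) = {g : gᵀJ₀g = J₀}` at a hyperspecial
vertex over a non-dyadic field, and «every `hd.`-theorem of the unitary chain applies»).  This file does the EXCLUDED case
`σ = id`, where the answer is different.

## The mathematics

`K` a field with a discrete valuation `v`, finite residue field `𝓀`, `q = #𝓀`, uniformiser `ϖ`; `σ = id`, so (trace) of the
datum reads `2t = 1`: `2 ∈ Kˣ` (`two_ne_zero_of_id`).  `G = O_N(J₀)`, `K₀ = G ∩ GL_N(𝒪)`, `K_P = B ∩ K₀` the integral points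
of the upper-triangular Borel, `t_μ = diag(ϖ^μ)` (`μ` antisymmetric, `μ_{i'} = -μ_i`, `i' = N-1-i`).  The root groups of
`G` inside the unitriangular group sit at the positions `(i, j)`, `i < j`, `i < j'` (paired with `(j', i')`); the
antidiagonal positions `(i, i')` carry NO root group: an element of `G ∩ U_{ℓ(i,i')}` has `x_{ii'} + x_{ii'} = 0`
(`map_entryHom_eq_of_eq_rev`: the image is the ball met with `ker(id + id) = ker(2·) = 0`, `ker_id_add_id_eq_bot`).  Running
the entry-by-entry recursion of g47-#1/#2 (`[A ∩ U_ℓ : B ∩ U_ℓ] = [e_{ij}(A ∩ U_ℓ) : e_{ij}(B ∩ U_ℓ)]·[A ∩ U_{ℓ+1} : B ∩ U_{ℓ+1}]`)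
with this single change gives, for every `N` and every antisymmetric `μ`,

  **`[K_P : K_P ∩ t_μK_Pt_μ⁻¹] = q^{P(μ)}`,  `P(μ) = ∑_{i<j, i<j'} (μ_i - μ_j)⁺`**,   `[t_μK_Pt_μ⁻¹ : K_P ∩ t_μK_Pt_μ⁻¹] = q^{P(-μ)}`

(Laumon's `δ_B = ∏_{α>0} |α|^{dim 𝔤_α}` with all root spaces of dimension `1`; compare `q^{P(μ)}·(√q)^{∑_{i<i'}(2μ_i)⁺}` for
`σ ≠ id`, g47-#2).  Since `P(μ) - P(-μ) = Λ(μ) := ∑_{i<j, i<j'} (μ_i - μ_j)` (`= ⟨2ρ, μ⟩` for the root system `D_m`, resp.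
`B_m`, `N = 2m`, resp. `2m+1`), the duality of `HyperspecialUnitarySatakeDuality` (g44-#3, valid for every `σ`) becomes
the COUNTING DUALITY WITH `q` EXPLICIT `#{γ ∈ K₀gK₀/K₀ : a(γ) = μ}·q^{(-Λ(μ))⁺} = #{γ : a(γ) = -μ}·q^{Λ(μ)⁺}`, the
dominant-extreme count `#{γ ∈ K₀t_cK₀/K₀ : a(γ) = -c} = q^{Λ(-c)}` (`c` antidominant), and, for every commutative ring `R`,
every unit `u ∈ Rˣ` with `u² = q` and the weight `w(e) = u^{-Λ(e)}` (`= δ_B^{1/2}`-normalisation of `O_N`), the `w₀`-SYMMETRY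
**`𝒮_w(T)_{-μ} = 𝒮_w(T)_μ`** for every `T ∈ ℋ(O_N(J₀), K₀; R)` and every `μ` (Cartier Thm. 4.1 for `w₀ = -1 ∈ W(B_m)`,
resp. `-1 ∈ W(D_m)` for `m` even and `-1 ∈ Aut` of the image for `m` odd; Satake 1963 §§8–9).  Finally the tree's
`ℂ`-valued `hd.satakeTransform`, whose weight `(√q)^{-⟨ν,·⟩}` is the half-sum of the UNITARY group, is for `σ = id` NOT
`w₀`-symmetric but twisted by an unramified character: **`𝒮(T)_{-μ} = q^{∑_{i<i'} μ_i} · 𝒮(T)_μ`**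
(`(√q)^{2⟨ν,μ⟩ - 2Λ(μ)} = (√q)^{∑_{i<i'} (μ_i - μ_{i'})}`), which makes precise in what sense «every `hd.`-theorem applies to
`O_N(J₀)`»: the statements hold verbatim, the normalisation is the unitary one.

## What is formalised (theorems only)

* §1 `two_ne_zero_of_id`, `ker_id_add_id_eq_bot`, the recursion `relIndex_inf_unitriangularFiltration_eq_prod_orthogonal`
  (product over the positions, factor `1` on and below the antidiagonal), `prod_filter_ite_eq_pow_sum`,
  `relIndex_conjAct_map_subtype_borelInt_eq_orthogonal`, **`relIndex_conjAct_borelInt_eq_orthogonal`** (`= q^{P(μ)}`),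
  **`relIndex_borelInt_conjAct_eq_orthogonal`** (`= q^{P(-μ)}`).
* §2 `toNat_sum_filter_sub_toNat_sum_filter` (`P(μ) - P(-μ) = Λ(μ)`), `relIndex_conjAct_borelInt_eq_pow_sum_orthogonal`
  (`μ` dominant: `q^{Λ(μ)}`), `relIndex_borelInt_conjAct_eq_pow_sum_orthogonal` (`c` antidominant),
  **`card_filter_iwasawaExp_orbit_neg_eq_pow_orthogonal`**, **`card_filter_iwasawaExp_mul_pow_eq_orthogonal`**.
* §3 `exists_weight_units_zpow_neg_orthogonal`, **`coeff_satakeTransform_neg_of_units_orthogonal`**,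
  `domCongr_neg_satakeTransform_of_units_orthogonal`, `satakeTransform_mem_setOf_of_units_orthogonal`.
* §4 `sum_filter_eq_rev_eq_sum`, `sum_filter_eq_rev_sub_eq_two_mul` (+ `natCast_card_residueField_pow` of
  `UnitaryRankOneSatakeClassical`), **`coeff_satakeTransform_neg_eq_zpow_mul_orthogonal`**, **`coeff_satakeTransform_neg_eq_pow_card_mul_orthogonal`** (the
  twist `q^{∑_{i<i'} μ_i}` of the unitarily normalised transform at `σ = id`).
* §5 `sum_eq_two_mul_sum_filter_lt_rev`, **`sum_filter_lt_rev_sub_eq_sum_mul`** (`Λ(μ) = ∑_{i<i'} (N-2-2i) μ_i`: the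
  coefficients of `2ρ` of `D_m` (`N = 2m`: `2(m-1-i)`), resp. `B_m` (`N = 2m+1`: `2(m-i)-1`)).

## References
* [Laumon1995] G. Laumon, *Cohomology of Drinfeld Modular Varieties I* (1995), (4.1.3)–(4.1.6).
* [CartierCorvallis1979] P. Cartier, *Representations of 𝔭-adic groups: a survey*, PSPM 33.1 (1979), §I.3, §IV (4.2), Thm. 4.1.
* [Satake1963] I. Satake, *Theory of spherical functions on reductive algebraic groups over 𝔭-adic fields*, Publ. Math.
  IHÉS 18 (1963), §§6–9.
* [Macdonald1995] I. G. Macdonald, *Symmetric Functions and Hall Polynomials*, 2nd ed. (1995), Ch. V (2.6)–(2.7).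
* [Tits1979] J. Tits, *Reductive groups over local fields*, PSPM 33.1 (1979), §3.3.3.
-/

noncomputable section

open scoped Valued WithZero Matrix MatrixGroups Pointwise
open MonoidAlgebra Representation Finset MulAction ConjAct

namespace Literature.NumberTheory.Automorphic.HermitianLattice

open Literature.NumberTheory.Automorphic.CartanUnique Literature.NumberTheory.Automorphic.SymplecticCartan
  Literature.NumberTheory.Automorphic

variable {K : Type*} [Field K] [Valued K ℤᵐ⁰] {ϖ : K} {N : ℕ}

/-! ## §1 The recursion for `σ = id`: the antidiagonal positions contribute nothing -/

namespace UnramifiedLocalConjDatum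

/-- For `σ = id` the trace condition of the datum reads `2t = 1`: `2 ≠ 0` in `K` (the non-dyadic hypothesis of
`SplitOrthogonalUnramifiedDatum`). [cite: Tits1979, §3.3.3] [cite: Satake1963, §§8–9] -/
theorem two_ne_zero_of_id (hd : UnramifiedLocalConjDatum (RingHom.id K) ϖ) : (2 : K) ≠ 0 := by
  obtain ⟨t, -, ht⟩ := hd.trace
  rw [RingHom.id_apply, ← two_mul] at ht
  intro h
  rw [h, zero_mul] at ht
  exact zero_ne_one ht

end UnramifiedLocalConjDatum

omit [Valued K ℤᵐ⁰] in
/-- `ker(id + id) = ker(2·) = 0` when `2 ≠ 0`: for `σ = id` there is no root group on the antidiagonal.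
[cite: Satake1963, §§8–9] [cite: Laumon1995, (4.1.3)] -/
theorem ker_id_add_id_eq_bot (h2 : (2 : K) ≠ 0) : (AddMonoidHom.id K + (RingHom.id K).toAddMonoidHom).ker = ⊥ := by
  ext x
  rw [mem_ker_id_add_iff, RingHom.id_apply, ← two_mul, mul_eq_zero, AddSubgroup.mem_bot]
  exact ⟨fun h => h.resolve_left h2, fun h => Or.inr h⟩

namespace UnramifiedLocalConjDatum

/-- The descending induction behind `relIndex_inf_unitriangularFiltration_eq_prod_orthogonal` (`σ = id`): the statement at
every level `m` with `m + k ≥ N²`, by induction on `k`. [cite: Laumon1995, (4.1.3)–(4.1.4)] [cite: CartierCorvallis1979, §I.3] -/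
private theorem relIndex_inf_unitriangularFiltration_eq_prod_orthogonal_aux (hd : UnramifiedLocalConjDatum (RingHom.id K) ϖ)
    [Finite 𝓀[K]] {A B : Subgroup (GL (Fin N) K)} {a b : Fin N → Fin N → ℤ}
    (hA : ∀ g : GL (Fin N) K, g ∈ A ↔ g ∈ unitaryGroupOfForm (RingHom.id K) ((StdForm.antidiagonal N).over K) ∧
      g ∈ upperUnitriangular (Fin N) K ∧
        ∀ p q, p < q → Valued.v ((g : Matrix (Fin N) (Fin N) K) p q) ≤ WithZero.exp (a p q))
    (ha : ∀ p q : Fin N, p < q → a (Fin.rev q) (Fin.rev p) = a p q)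
    (ha' : ∀ i c : Fin N, i < c → Fin.rev c = c → 2 * a i c ≤ a i (Fin.rev i))
    (hB : ∀ g : GL (Fin N) K, g ∈ B ↔ g ∈ unitaryGroupOfForm (RingHom.id K) ((StdForm.antidiagonal N).over K) ∧
      g ∈ upperUnitriangular (Fin N) K ∧
        ∀ p q, p < q → Valued.v ((g : Matrix (Fin N) (Fin N) K) p q) ≤ WithZero.exp (b p q))
    (hb : ∀ p q : Fin N, p < q → b (Fin.rev q) (Fin.rev p) = b p q)
    (hb' : ∀ i c : Fin N, i < c → Fin.rev c = c → 2 * b i c ≤ b i (Fin.rev i)) (hBA : B ≤ A) (k : ℕ) :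
    ∀ m : ℕ, N * N ≤ m + k →
      (B ⊓ unitriangularFiltration N K m).relIndex (A ⊓ unitriangularFiltration N K m) =
        ∏ p ∈ (Finset.univ : Finset (Fin N × Fin N)) with (p.1 < p.2 ∧ m ≤ entryLevel p.1 p.2),
          (if p.1 < Fin.rev p.2 then Nat.card 𝓀[K] ^ (a p.1 p.2 - b p.1 p.2).toNat else 1) := by
  have hAG : A ≤ unitaryGroupOfForm (RingHom.id K) ((StdForm.antidiagonal N).over K) := fun g hg => ((hA g).1 hg).1
  have hBG : B ≤ unitaryGroupOfForm (RingHom.id K) ((StdForm.antidiagonal N).over K) := fun g hg => ((hB g).1 hg).1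
  have hker := ker_id_add_id_eq_bot hd.two_ne_zero_of_id
  induction k with
  | zero =>
    intro m hm
    rw [add_zero] at hm
    rw [relIndex_inf_unitriangularFiltration_of_mul_self_le A B hm]
    symm
    refine Finset.prod_eq_one fun p hp => ?_
    obtain ⟨-, h2⟩ := (Finset.mem_filter.1 hp).2
    exact absurd ((entryLevel_lt_mul_self p.1 p.2).trans_le (hm.trans h2)) (lt_irrefl _)
  | succ k ih =>
    intro m hm
    have ih' := ih (m + 1) (by omega)
    by_cases hex : ∃ i j : Fin N, i < j ∧ entryLevel i j = m
    · obtain ⟨i, j, hij, rfl⟩ := hex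
      -- split off the factor of the position `(i, j)`
      have hmem : (i, j) ∈ (Finset.univ : Finset (Fin N × Fin N)).filter
          (fun p => p.1 < p.2 ∧ entryLevel i j ≤ entryLevel p.1 p.2) :=
        Finset.mem_filter.2 ⟨Finset.mem_univ _, hij, le_rfl⟩
      have herase : ((Finset.univ : Finset (Fin N × Fin N)).filter
          (fun p => p.1 < p.2 ∧ entryLevel i j ≤ entryLevel p.1 p.2)).erase (i, j) =
            (Finset.univ : Finset (Fin N × Fin N)).filter (fun p => p.1 < p.2 ∧ entryLevel i j + 1 ≤ entryLevel p.1 p.2) := by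
        ext p
        simp only [Finset.mem_erase, Finset.mem_filter, Finset.mem_univ, true_and]
        constructor
        · rintro ⟨hne, hp, hle⟩
          refine ⟨hp, lt_of_le_of_ne hle fun h => hne ?_⟩
          obtain ⟨h1, h2⟩ := entryLevel_inj hp hij h.symm
          exact Prod.ext h1 h2
        · rintro ⟨hp, hlt⟩
          refine ⟨fun h => ?_, hp, (Nat.le_succ _).trans hlt⟩
          rw [h] at hlt
          exact absurd hlt (Nat.lt_irrefl _)
      rw [← Finset.mul_prod_erase _ _ hmem, herase, ← ih']
      rcases lt_trichotomy i (Fin.rev j) with h | h | h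
      · -- strictly above the antidiagonal: `[{v ≤ exp a_{ij}} : {v ≤ exp b_{ij}}] = q^{(a-b)⁺}`
        rw [relIndex_inf_unitriangularFiltration_eq_mul hBA hij, hd.map_entryHom_eq_of_lt_rev hB hb hb' hij h,
          hd.map_entryHom_eq_of_lt_rev hA ha ha' hij h, relIndex_toSubgroup_leAddSubgroup_exp hd.vϖ, if_pos h]
      · -- on the antidiagonal: both images are `{v ≤ exp c} ∩ ker(2·) = 0`, index `1`
        have hj : j = Fin.rev i := by rw [h, Fin.rev_rev]
        have hn : ¬ i < Fin.rev j := by rw [← h]; exact lt_irrefl _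
        rw [relIndex_inf_unitriangularFiltration_eq_mul hBA hij, map_entryHom_eq_of_eq_rev hB hij hj,
          map_entryHom_eq_of_eq_rev hA hij hj, hker, inf_bot_eq, inf_bot_eq, Subgroup.relIndex_self, if_neg hn]
      · -- strictly below the antidiagonal: no contribution
        have hn : ¬ i < Fin.rev j := fun h' => lt_asymm h h'
        rw [inf_unitriangularFiltration_entryLevel_eq_of_rev_lt hAG hij h,
          inf_unitriangularFiltration_entryLevel_eq_of_rev_lt hBG hij h, if_neg hn, one_mul]
    · -- `m` is not a level: nothing happens
      have hne : ∀ i j : Fin N, i < j → entryLevel i j ≠ m := fun i j hij h => hex ⟨i, j, hij, h⟩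
      rw [← relIndex_inf_unitriangularFiltration_succ_eq_of_forall_ne A B hne, ih']
      refine Finset.prod_congr ?_ fun _ _ => rfl
      ext p
      simp only [Finset.mem_filter, Finset.mem_univ, true_and]
      constructor
      · rintro ⟨hp, hle⟩
        exact ⟨hp, (Nat.le_succ _).trans hle⟩
      · rintro ⟨hp, hle⟩
        exact ⟨hp, lt_of_le_of_ne hle fun h => hne p.1 p.2 hp h.symm⟩

/-- **THE INDEX AS A PRODUCT OVER THE POSITIONS, `σ = id`.**  Let `A ⊇ B` be two subgroups of `GL_N(K)` of the shape
`{g ∈ O_N(J₀) unitriangular : v(g_{pq}) ≤ exp c_{pq} (p < q)}` (`c = a`, resp. `b`) with `c_{q'p'} = c_{pq}` and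
`2c_{ic} ≤ c_{ii'}` at the middle column.  Then for every `m`,
`[A ∩ U_m : B ∩ U_m] = ∏_{i<j, ℓ(i,j) ≥ m, i<j'} q^{(a_{ij}-b_{ij})⁺}` — the positions on and below the antidiagonal contribute
nothing (`δ_B = ∏_{α>0} |α|`, all root spaces of the split group one-dimensional). [cite: Laumon1995, (4.1.3)–(4.1.4)]
[cite: CartierCorvallis1979, §I.3, §IV (4.2)] [cite: Satake1963, §§8–9] -/
theorem relIndex_inf_unitriangularFiltration_eq_prod_orthogonal (hd : UnramifiedLocalConjDatum (RingHom.id K) ϖ)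
    [Finite 𝓀[K]] {A B : Subgroup (GL (Fin N) K)} {a b : Fin N → Fin N → ℤ}
    (hA : ∀ g : GL (Fin N) K, g ∈ A ↔ g ∈ unitaryGroupOfForm (RingHom.id K) ((StdForm.antidiagonal N).over K) ∧
      g ∈ upperUnitriangular (Fin N) K ∧
        ∀ p q, p < q → Valued.v ((g : Matrix (Fin N) (Fin N) K) p q) ≤ WithZero.exp (a p q))
    (ha : ∀ p q : Fin N, p < q → a (Fin.rev q) (Fin.rev p) = a p q)
    (ha' : ∀ i c : Fin N, i < c → Fin.rev c = c → 2 * a i c ≤ a i (Fin.rev i))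
    (hB : ∀ g : GL (Fin N) K, g ∈ B ↔ g ∈ unitaryGroupOfForm (RingHom.id K) ((StdForm.antidiagonal N).over K) ∧
      g ∈ upperUnitriangular (Fin N) K ∧
        ∀ p q, p < q → Valued.v ((g : Matrix (Fin N) (Fin N) K) p q) ≤ WithZero.exp (b p q))
    (hb : ∀ p q : Fin N, p < q → b (Fin.rev q) (Fin.rev p) = b p q)
    (hb' : ∀ i c : Fin N, i < c → Fin.rev c = c → 2 * b i c ≤ b i (Fin.rev i)) (hBA : B ≤ A) (m : ℕ) :
    (B ⊓ unitriangularFiltration N K m).relIndex (A ⊓ unitriangularFiltration N K m) =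
      ∏ p ∈ (Finset.univ : Finset (Fin N × Fin N)) with (p.1 < p.2 ∧ m ≤ entryLevel p.1 p.2),
        (if p.1 < Fin.rev p.2 then Nat.card 𝓀[K] ^ (a p.1 p.2 - b p.1 p.2).toNat else 1) :=
  relIndex_inf_unitriangularFiltration_eq_prod_orthogonal_aux hd hA ha ha' hB hb hb' hBA (N * N) m (Nat.le_add_left _ _)

end UnramifiedLocalConjDatum

omit [Valued K ℤᵐ⁰] in
/-- Bookkeeping: the product over all positions of `q^{f}` (strictly above the antidiagonal) and `1` (elsewhere) is
`q^{∑ f}`. [cite: Laumon1995, (4.1.4)] -/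
theorem prod_filter_ite_eq_pow_sum (f : Fin N × Fin N → ℕ) (q : ℕ) :
    ∏ p ∈ (Finset.univ : Finset (Fin N × Fin N)) with (p.1 < p.2 ∧ 0 ≤ entryLevel p.1 p.2),
        (if p.1 < Fin.rev p.2 then q ^ f p else 1) =
      q ^ (∑ p ∈ (Finset.univ : Finset (Fin N × Fin N)) with (p.1 < p.2 ∧ p.1 < Fin.rev p.2), f p) := by
  rw [Finset.prod_ite, Finset.prod_pow_eq_pow_sum, Finset.prod_const_one, mul_one]
  congr 1
  refine Finset.sum_congr (Finset.ext fun p => ?_) fun _ _ => rfl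
  simp only [Finset.mem_filter, Finset.mem_univ, true_and]
  exact ⟨fun h => ⟨h.1.1, h.2⟩, fun h => ⟨⟨h.1, Nat.zero_le _⟩, h.2⟩⟩

namespace UnramifiedLocalConjDatum

/-- **`[K_P : K_P ∩ t_μK_Pt_μ⁻¹]` FOR `O_N(J₀)` AND EVERY `N`**, inside `GL_N(K)`: for `σ = id`, finite residue field
`q = #𝓀[K]` and every antisymmetric `μ`, `[K_P : K_P ∩ t_μK_Pt_μ⁻¹] = q^{∑_{i<j, i<j'} (μ_i-μ_j)⁺}`.
[cite: Laumon1995, (4.1.3)–(4.1.4)] [cite: CartierCorvallis1979, §I.3, §IV (4.2)] [cite: Satake1963, §§8–9] -/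
theorem relIndex_conjAct_map_subtype_borelInt_eq_orthogonal (hd : UnramifiedLocalConjDatum (RingHom.id K) ϖ)
    [Finite 𝓀[K]] {μ : Fin N → ℤ} (hμ : ∀ i, μ (Fin.rev i) = -μ i) :
    (toConjAct (zpowDiagGL (uniformizer_ne_zero hd.vϖ) μ) •
          (hd.borelLatticeU ⊓ unitaryInt (RingHom.id K) ((StdForm.antidiagonal N).over K)).map
            (unitaryGroupOfForm (RingHom.id K) ((StdForm.antidiagonal N).over K)).subtype).relIndex
        ((hd.borelLatticeU ⊓ unitaryInt (RingHom.id K) ((StdForm.antidiagonal N).over K)).map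
          (unitaryGroupOfForm (RingHom.id K) ((StdForm.antidiagonal N).over K)).subtype) =
      Nat.card 𝓀[K] ^ (∑ p ∈ (Finset.univ : Finset (Fin N × Fin N)) with (p.1 < p.2 ∧ p.1 < Fin.rev p.2),
          (μ p.1 - μ p.2).toNat) := by
  set KP := (hd.borelLatticeU ⊓ unitaryInt (RingHom.id K) ((StdForm.antidiagonal N).over K)).map
    (unitaryGroupOfForm (RingHom.id K) ((StdForm.antidiagonal N).over K)).subtype with hKP
  have hA := fun g : GL (Fin N) K => hd.mem_map_subtype_borelInt_iff_lt (g := g)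
  have hB := fun g : GL (Fin N) K => hd.mem_inf_conjAct_smul_map_subtype_borelInt_iff hμ (g := g)
  have hAU : KP ≤ upperUnitriangular (Fin N) K := fun g hg => ((hA g).1 hg).2.1
  have hBU : KP ⊓ toConjAct (zpowDiagGL (uniformizer_ne_zero hd.vϖ) μ) • KP ≤ upperUnitriangular (Fin N) K :=
    fun g hg => ((hB g).1 hg).2.1
  have hμ0 : ∀ c : Fin N, Fin.rev c = c → μ c = 0 := fun c hc => by
    have h := hμ c
    rw [hc] at h
    omega
  rw [← Subgroup.inf_relIndex_right, inf_comm, ← relIndex_inf_unitriangularFiltration_zero hAU hBU,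
    hd.relIndex_inf_unitriangularFiltration_eq_prod_orthogonal (a := fun _ _ => (0 : ℤ)) (b := fun p q => min 0 (μ q - μ p))
      hA (fun _ _ _ => rfl) (fun _ _ _ _ => by simp only [mul_zero, le_refl]) hB
      (fun p q _ => by rw [hμ, hμ, neg_sub_neg]) (fun i c _ hc => by rw [hμ0 c hc, hμ i]; omega) inf_le_left 0,
    prod_filter_ite_eq_pow_sum (fun p : Fin N × Fin N => ((0 : ℤ) - min 0 (μ p.2 - μ p.1)).toNat)]
  congr 1
  exact Finset.sum_congr rfl fun p _ => by omega

/-- **THE MODULUS OF THE BOREL OF THE SPLIT ORTHOGONAL GROUP AS AN INDEX, FOR EVERY `N`**: for `σ = id`, `q = #𝓀[K]`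
finite and every antisymmetric `μ` (`t_μ = diag(ϖ^μ) ∈ O_N(J₀)`),
**`[K_P : K_P ∩ t_μK_Pt_μ⁻¹] = q^{∑_{i<j, i<j'} (μ_i-μ_j)⁺}`** — NO factor from the antidiagonal positions (compare
`q^{…}·(√q)^{∑_{i<i'}(2μ_i)⁺}` for `σ ≠ id`, g47-#2). [cite: Laumon1995, (4.1.3)–(4.1.6)] [cite: CartierCorvallis1979, §I.3, §IV (4.2)]
[cite: Satake1963, §§8–9] [cite: Macdonald1995, Ch. V (2.6)] -/
theorem relIndex_conjAct_borelInt_eq_orthogonal (hd : UnramifiedLocalConjDatum (RingHom.id K) ϖ) [Finite 𝓀[K]]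
    {μ : Fin N → ℤ} (hμ : ∀ i, μ (Fin.rev i) = -μ i) :
    (toConjAct (⟨zpowDiagGL (uniformizer_ne_zero hd.vϖ) μ, zpowDiagGL_mem_unitaryGroupOfForm hd.σϖ _ hμ⟩ :
          unitaryGroupOfForm (RingHom.id K) ((StdForm.antidiagonal N).over K)) •
        (hd.borelLatticeU ⊓ unitaryInt (RingHom.id K) ((StdForm.antidiagonal N).over K))).relIndex
        (hd.borelLatticeU ⊓ unitaryInt (RingHom.id K) ((StdForm.antidiagonal N).over K)) =
      Nat.card 𝓀[K] ^ (∑ p ∈ (Finset.univ : Finset (Fin N × Fin N)) with (p.1 < p.2 ∧ p.1 < Fin.rev p.2),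
          (μ p.1 - μ p.2).toNat) := by
  rw [← Subgroup.relIndex_map_map_of_injective _ _
    (unitaryGroupOfForm (RingHom.id K) ((StdForm.antidiagonal N).over K)).subtype_injective,
    hd.map_subtype_conjAct_smul_borelInt hμ, hd.relIndex_conjAct_map_subtype_borelInt_eq_orthogonal hμ]

/-- **The dual index `[t_μK_Pt_μ⁻¹ : K_P ∩ t_μK_Pt_μ⁻¹] = q^{∑_{i<j, i<j'} (μ_j-μ_i)⁺} = q^{P(-μ)}`** (`σ = id`; conjugate by
`t_μ⁻¹ = t_{-μ}`). [cite: Laumon1995, (4.1.4)–(4.1.6)] [cite: CartierCorvallis1979, §IV (4.2)] [cite: Satake1963, §§8–9] -/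
theorem relIndex_borelInt_conjAct_eq_orthogonal (hd : UnramifiedLocalConjDatum (RingHom.id K) ϖ) [Finite 𝓀[K]]
    {μ : Fin N → ℤ} (hμ : ∀ i, μ (Fin.rev i) = -μ i) :
    (hd.borelLatticeU ⊓ unitaryInt (RingHom.id K) ((StdForm.antidiagonal N).over K)).relIndex
        (toConjAct (⟨zpowDiagGL (uniformizer_ne_zero hd.vϖ) μ, zpowDiagGL_mem_unitaryGroupOfForm hd.σϖ _ hμ⟩ :
            unitaryGroupOfForm (RingHom.id K) ((StdForm.antidiagonal N).over K)) •
          (hd.borelLatticeU ⊓ unitaryInt (RingHom.id K) ((StdForm.antidiagonal N).over K))) =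
      Nat.card 𝓀[K] ^ (∑ p ∈ (Finset.univ : Finset (Fin N × Fin N)) with (p.1 < p.2 ∧ p.1 < Fin.rev p.2),
          (μ p.2 - μ p.1).toNat) := by
  have hneg : ∀ i, (-μ) (Fin.rev i) = -(-μ) i := fun i => by rw [Pi.neg_apply, Pi.neg_apply, hμ]
  have e : (⟨zpowDiagGL (uniformizer_ne_zero hd.vϖ) (-μ), zpowDiagGL_mem_unitaryGroupOfForm hd.σϖ _ hneg⟩ :
        unitaryGroupOfForm (RingHom.id K) ((StdForm.antidiagonal N).over K)) =
      (⟨zpowDiagGL (uniformizer_ne_zero hd.vϖ) μ, zpowDiagGL_mem_unitaryGroupOfForm hd.σϖ _ hμ⟩ :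
        unitaryGroupOfForm (RingHom.id K) ((StdForm.antidiagonal N).over K))⁻¹ :=
    Subtype.ext (zpowDiagGL_neg _ μ)
  have h := hd.relIndex_conjAct_borelInt_eq_orthogonal hneg
  rw [e, toConjAct_inv] at h
  have e' := Subgroup.relIndex_pointwise_smul
    (toConjAct (⟨zpowDiagGL (uniformizer_ne_zero hd.vϖ) μ, zpowDiagGL_mem_unitaryGroupOfForm hd.σϖ _ hμ⟩ :
      unitaryGroupOfForm (RingHom.id K) ((StdForm.antidiagonal N).over K)))⁻¹
    (hd.borelLatticeU ⊓ unitaryInt (RingHom.id K) ((StdForm.antidiagonal N).over K))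
    (toConjAct (⟨zpowDiagGL (uniformizer_ne_zero hd.vϖ) μ, zpowDiagGL_mem_unitaryGroupOfForm hd.σϖ _ hμ⟩ :
      unitaryGroupOfForm (RingHom.id K) ((StdForm.antidiagonal N).over K)) •
        (hd.borelLatticeU ⊓ unitaryInt (RingHom.id K) ((StdForm.antidiagonal N).over K)))
  rw [inv_smul_smul] at e'
  rw [← e', h]
  simp only [Pi.neg_apply, sub_neg_eq_add, neg_add_eq_sub]

end UnramifiedLocalConjDatum

/-! ## §2 Dominant and antidominant closed forms; the counting duality with `q` explicit -/

omit [Valued K ℤᵐ⁰] in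
/-- **`P(μ) - P(-μ) = Λ(μ) = ∑_{i<j, i<j'} (μ_i - μ_j)`** (termwise `x⁺ - (-x)⁺ = x`): the exponents of the two indices differ
by a LINEAR functional of `μ` (`= ⟨2ρ, μ⟩`, `ρ` the half-sum of the positive roots of the split group).
[cite: Laumon1995, (4.1.4)–(4.1.6)] [cite: CartierCorvallis1979, §IV (4.2)] -/
theorem toNat_sum_filter_sub_toNat_sum_filter (μ : Fin N → ℤ) :
    ((∑ p ∈ (Finset.univ : Finset (Fin N × Fin N)) with (p.1 < p.2 ∧ p.1 < Fin.rev p.2), (μ p.1 - μ p.2).toNat : ℕ) : ℤ) -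
        ((∑ p ∈ (Finset.univ : Finset (Fin N × Fin N)) with (p.1 < p.2 ∧ p.1 < Fin.rev p.2), (μ p.2 - μ p.1).toNat : ℕ) : ℤ) =
      ∑ p ∈ (Finset.univ : Finset (Fin N × Fin N)) with (p.1 < p.2 ∧ p.1 < Fin.rev p.2), (μ p.1 - μ p.2) := by
  have h := toNat_sum_sub_toNat_sum_neg
    ((Finset.univ : Finset (Fin N × Fin N)).filter fun p => p.1 < p.2 ∧ p.1 < Fin.rev p.2) fun p => μ p.1 - μ p.2
  simp only [neg_sub] at h
  exact h

namespace UnramifiedLocalConjDatum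

/-- **THE MODULUS FOR DOMINANT `μ`: `[K_P : t_μK_Pt_μ⁻¹] = q^{∑_{i<j, i<j'} (μ_i - μ_j)} = q^{⟨2ρ, μ⟩}`** (`σ = id`, `μ` antitone
and antisymmetric; then `t_μK_Pt_μ⁻¹ ≤ K_P`): the modulus `δ_B(t_μ)⁻¹ = ∏_{α>0} |α(t_μ)|⁻¹` of the Borel subgroup of the
split orthogonal group in `N` variables. [cite: Laumon1995, (4.1.3)–(4.1.6)] [cite: CartierCorvallis1979, §IV (4.2)]
[cite: Macdonald1995, Ch. V (2.6)] [cite: Satake1963, §§8–9] -/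
theorem relIndex_conjAct_borelInt_eq_pow_sum_orthogonal (hd : UnramifiedLocalConjDatum (RingHom.id K) ϖ) [Finite 𝓀[K]]
    {μ : Fin N → ℤ} (hμa : Antitone μ) (hμ : ∀ i, μ (Fin.rev i) = -μ i) :
    (toConjAct (⟨zpowDiagGL (uniformizer_ne_zero hd.vϖ) μ, zpowDiagGL_mem_unitaryGroupOfForm hd.σϖ _ hμ⟩ :
          unitaryGroupOfForm (RingHom.id K) ((StdForm.antidiagonal N).over K)) •
        (hd.borelLatticeU ⊓ unitaryInt (RingHom.id K) ((StdForm.antidiagonal N).over K))).relIndex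
        (hd.borelLatticeU ⊓ unitaryInt (RingHom.id K) ((StdForm.antidiagonal N).over K)) =
      Nat.card 𝓀[K] ^
        (∑ p ∈ (Finset.univ : Finset (Fin N × Fin N)) with (p.1 < p.2 ∧ p.1 < Fin.rev p.2), (μ p.1 - μ p.2)).toNat := by
  rw [hd.relIndex_conjAct_borelInt_eq_orthogonal hμ]
  congr 1
  have hnn : ∀ p ∈ (Finset.univ : Finset (Fin N × Fin N)).filter (fun p => p.1 < p.2 ∧ p.1 < Fin.rev p.2),
      0 ≤ μ p.1 - μ p.2 := fun p hp => sub_nonneg.2 (hμa (Finset.mem_filter.1 hp).2.1.le)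
  apply Nat.cast_injective (R := ℤ)
  rw [Nat.cast_sum, Int.toNat_of_nonneg (Finset.sum_nonneg hnn)]
  exact Finset.sum_congr rfl fun p hp => Int.toNat_of_nonneg (hnn p hp)

/-- **The dual index for ANTIDOMINANT `c`** (`c` monotone and antisymmetric, `σ = id`):
`[t_cK_Pt_c⁻¹ : K_P] = q^{∑_{i<j, i<j'} (c_j - c_i)}` (then `K_P ≤ t_cK_Pt_c⁻¹`; `= q^{-⟨2ρ, c⟩}`).
[cite: Laumon1995, (4.1.4)–(4.1.6)] [cite: CartierCorvallis1979, §IV (4.2)] [cite: Satake1963, §§8–9] -/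
theorem relIndex_borelInt_conjAct_eq_pow_sum_orthogonal (hd : UnramifiedLocalConjDatum (RingHom.id K) ϖ) [Finite 𝓀[K]]
    {c : Fin N → ℤ} (hc : Monotone c) (hc' : ∀ i, c (Fin.rev i) = -c i) :
    (hd.borelLatticeU ⊓ unitaryInt (RingHom.id K) ((StdForm.antidiagonal N).over K)).relIndex
        (toConjAct (⟨zpowDiagGL (uniformizer_ne_zero hd.vϖ) c, zpowDiagGL_mem_unitaryGroupOfForm hd.σϖ _ hc'⟩ :
            unitaryGroupOfForm (RingHom.id K) ((StdForm.antidiagonal N).over K)) •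
          (hd.borelLatticeU ⊓ unitaryInt (RingHom.id K) ((StdForm.antidiagonal N).over K))) =
      Nat.card 𝓀[K] ^
        (∑ p ∈ (Finset.univ : Finset (Fin N × Fin N)) with (p.1 < p.2 ∧ p.1 < Fin.rev p.2), (c p.2 - c p.1)).toNat := by
  rw [hd.relIndex_borelInt_conjAct_eq_orthogonal hc']
  congr 1
  have hnn : ∀ p ∈ (Finset.univ : Finset (Fin N × Fin N)).filter (fun p => p.1 < p.2 ∧ p.1 < Fin.rev p.2),
      0 ≤ c p.2 - c p.1 := fun p hp => sub_nonneg.2 (hc (Finset.mem_filter.1 hp).2.1.le)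
  apply Nat.cast_injective (R := ℤ)
  rw [Nat.cast_sum, Int.toNat_of_nonneg (Finset.sum_nonneg hnn)]
  exact Finset.sum_congr rfl fun p hp => Int.toNat_of_nonneg (hnn p hp)

/-- **THE DOMINANT-EXTREME COSET COUNT FOR `O_N(J₀)` AND EVERY `N`**: for `c` antidominant (monotone, antisymmetric) the
number of left `K₀`-cosets `γ` of `K₀t_cK₀` with Iwasawa exponent `a(γ) = -c` is
`#{γ ∈ K₀t_cK₀/K₀ : a(γ) = -c} = [t_cK_Pt_c⁻¹ : K_P] = q^{∑_{i<j, i<j'} (c_j - c_i)} = q^{⟨2ρ, -c⟩}` (Macdonald's leading term for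
the split group: an honest power of `q`). [cite: Macdonald1995, Ch. V (2.6)–(2.7)] [cite: Laumon1995, (4.1.6)]
[cite: CartierCorvallis1979, §IV (4.2)] [cite: Satake1963, §§8–9] -/
theorem card_filter_iwasawaExp_orbit_neg_eq_pow_orthogonal
    [IsHeckeTriple (⊤ : Submonoid (unitaryGroupOfForm (RingHom.id K) ((StdForm.antidiagonal N).over K)))
      (unitaryInt (RingHom.id K) ((StdForm.antidiagonal N).over K)) (unitaryInt (RingHom.id K) ((StdForm.antidiagonal N).over K))]
    (hd : UnramifiedLocalConjDatum (RingHom.id K) ϖ) [Finite 𝓀[K]] {c : Fin N → ℤ} (hc : Monotone c)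
    (hc' : ∀ i, c (Fin.rev i) = -c i)
    [DecidablePred fun α : unitaryGroupOfForm (RingHom.id K) ((StdForm.antidiagonal N).over K) ⧸
        unitaryInt (RingHom.id K) ((StdForm.antidiagonal N).over K) => hd.iwasawaExp α.out = -c] :
    ((finite_orbit_quotient (unitaryInt (RingHom.id K) ((StdForm.antidiagonal N).over K))
        (⟨zpowDiagGL (uniformizer_ne_zero hd.vϖ) c, zpowDiagGL_mem_unitaryGroupOfForm hd.σϖ _ hc'⟩ :
          unitaryGroupOfForm (RingHom.id K) ((StdForm.antidiagonal N).over K))).toFinset.filter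
          (fun α => hd.iwasawaExp α.out = -c)).card =
      Nat.card 𝓀[K] ^
        (∑ p ∈ (Finset.univ : Finset (Fin N × Fin N)) with (p.1 < p.2 ∧ p.1 < Fin.rev p.2), (c p.2 - c p.1)).toNat := by
  rw [hd.card_filter_iwasawaExp_orbit_neg_eq_relIndex_unitary hc hc', hd.relIndex_borelInt_conjAct_eq_pow_sum_orthogonal hc hc']

/-- **COUNTING DUALITY WITH `q` EXPLICIT FOR `O_N(J₀)` AND EVERY `N`**: for every `g ∈ O_N(J₀)` and every antisymmetric `μ`,
`#{γ ∈ K₀gK₀/K₀ : a(γ) = μ} · q^{(-Λ(μ))⁺} = #{γ ∈ K₀gK₀/K₀ : a(γ) = -μ} · q^{Λ(μ)⁺}`, `Λ(μ) = ∑_{i<j, i<j'} (μ_i - μ_j)`: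
g44-#3's duality with both indices evaluated (§1) and the common power of `q` cancelled.
[cite: CartierCorvallis1979, §IV (4.2), Thm. 4.1] [cite: Macdonald1995, Ch. V (2.6)–(2.7)] [cite: Laumon1995, (4.1.4)–(4.1.6)]
[cite: Satake1963, §§8–9] -/
theorem card_filter_iwasawaExp_mul_pow_eq_orthogonal
    [IsHeckeTriple (⊤ : Submonoid (unitaryGroupOfForm (RingHom.id K) ((StdForm.antidiagonal N).over K)))
      (unitaryInt (RingHom.id K) ((StdForm.antidiagonal N).over K)) (unitaryInt (RingHom.id K) ((StdForm.antidiagonal N).over K))]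
    (hd : UnramifiedLocalConjDatum (RingHom.id K) ϖ) [Finite 𝓀[K]]
    (g : unitaryGroupOfForm (RingHom.id K) ((StdForm.antidiagonal N).over K)) {μ : Fin N → ℤ} (hμ : ∀ i, μ (Fin.rev i) = -μ i)
    [DecidablePred fun α : unitaryGroupOfForm (RingHom.id K) ((StdForm.antidiagonal N).over K) ⧸
        unitaryInt (RingHom.id K) ((StdForm.antidiagonal N).over K) => hd.iwasawaExp α.out = μ]
    [DecidablePred fun α : unitaryGroupOfForm (RingHom.id K) ((StdForm.antidiagonal N).over K) ⧸
        unitaryInt (RingHom.id K) ((StdForm.antidiagonal N).over K) => hd.iwasawaExp α.out = -μ] :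
    ((finite_orbit_quotient (unitaryInt (RingHom.id K) ((StdForm.antidiagonal N).over K)) g).toFinset.filter
          (fun α => hd.iwasawaExp α.out = μ)).card *
        Nat.card 𝓀[K] ^ (-∑ p ∈ (Finset.univ : Finset (Fin N × Fin N)) with (p.1 < p.2 ∧ p.1 < Fin.rev p.2),
          (μ p.1 - μ p.2)).toNat =
      ((finite_orbit_quotient (unitaryInt (RingHom.id K) ((StdForm.antidiagonal N).over K)) g).toFinset.filter
          (fun α => hd.iwasawaExp α.out = -μ)).card *
        Nat.card 𝓀[K] ^ (∑ p ∈ (Finset.univ : Finset (Fin N × Fin N)) with (p.1 < p.2 ∧ p.1 < Fin.rev p.2),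
          (μ p.1 - μ p.2)).toNat := by
  have key := hd.card_filter_iwasawaExp_mul_relIndex_eq_unitary g hμ
  rw [hd.relIndex_borelInt_conjAct_eq_orthogonal hμ, hd.relIndex_conjAct_borelInt_eq_orthogonal hμ] at key
  have hS := toNat_sum_filter_sub_toNat_sum_filter μ
  set e := ∑ p ∈ (Finset.univ : Finset (Fin N × Fin N)) with (p.1 < p.2 ∧ p.1 < Fin.rev p.2), (μ p.1 - μ p.2).toNat with he
  set e' := ∑ p ∈ (Finset.univ : Finset (Fin N × Fin N)) with (p.1 < p.2 ∧ p.1 < Fin.rev p.2), (μ p.2 - μ p.1).toNat with he'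
  set S := ∑ p ∈ (Finset.univ : Finset (Fin N × Fin N)) with (p.1 < p.2 ∧ p.1 < Fin.rev p.2), (μ p.1 - μ p.2) with hSdef
  obtain ⟨m, hme, hme'⟩ : ∃ m : ℕ, e = m + S.toNat ∧ e' = m + (-S).toNat := ⟨e - S.toNat, by omega, by omega⟩
  have hpos : 0 < Nat.card 𝓀[K] ^ m := pow_pos Nat.card_pos m
  rw [hme, hme', pow_add, pow_add, ← mul_assoc, ← mul_assoc, mul_comm _ (Nat.card 𝓀[K] ^ m),
    mul_comm _ (Nat.card 𝓀[K] ^ m), mul_assoc, mul_assoc] at key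
  exact Nat.eq_of_mul_eq_mul_left hpos key

/-! ## §3 The `w₀`-symmetry of the orthogonally normalised Satake transform over any commutative ring -/

variable {R : Type*} [CommRing R]

omit [Valued K ℤᵐ⁰] in
/-- **A weight `w(e) = u^{-Λ(e)}` exists** for every unit `u` (`Λ(e) = ∑_{i<j, i<j'} (e_i - e_j)` is additive); for `u² = q`
this is the `δ_B^{1/2}`-normalisation of the split orthogonal group. [cite: CartierCorvallis1979, §IV (4.2)] [cite: Satake1963, §§8–9] -/
theorem exists_weight_units_zpow_neg_orthogonal (u : Rˣ) :
    ∃ w : Multiplicative (Fin N → ℤ) →* R, ∀ e : Fin N → ℤ, w (Multiplicative.ofAdd e) =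
      ((u ^ (-∑ p ∈ (Finset.univ : Finset (Fin N × Fin N)) with (p.1 < p.2 ∧ p.1 < Fin.rev p.2), (e p.1 - e p.2)) : Rˣ) : R) := by
  obtain ⟨w, hw⟩ := exists_monoidHom_apply_ofAdd_eq_units_zpow (Λ := Fin N → ℤ) u
    (-(AddMonoidHom.mk' (fun e : Fin N → ℤ =>
        ∑ p ∈ (Finset.univ : Finset (Fin N × Fin N)) with (p.1 < p.2 ∧ p.1 < Fin.rev p.2), (e p.1 - e p.2))
      (fun e f => by
        rw [← Finset.sum_add_distrib]
        exact Finset.sum_congr rfl fun p _ => by simp only [Pi.add_apply]; ring)))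
  exact ⟨w, fun e => by rw [hw]; rfl⟩

variable [Finite 𝓀[K]]
  [IsHeckeTriple (⊤ : Submonoid (unitaryGroupOfForm (RingHom.id K) ((StdForm.antidiagonal N).over K)))
    (unitaryInt (RingHom.id K) ((StdForm.antidiagonal N).over K)) (unitaryInt (RingHom.id K) ((StdForm.antidiagonal N).over K))]

/-- **`𝒮_w(T)_{-μ} = 𝒮_w(T)_μ` OVER ANY COMMUTATIVE RING `R`, FOR `O_N(J₀)` AND EVERY `N`**, every `T ∈ ℋ(O_N(J₀), K₀; R)` and
every `μ`, for the Satake transform with the ORTHOGONAL weight `w(e) = u^{-Λ(e)}`, `u ∈ Rˣ` with `u² = q`: in g44-#3's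
duality both indices are powers of `q = u²` (§1) and `Λ(μ) + 2P(-μ) = -Λ(μ) + 2P(μ)` (§2), so the common unit cancels; off the
antisymmetric cocharacters both coefficients vanish.  Cartier's Theorem 4.1 for the element `-1` (in `W(B_m)`, `N = 2m+1`;
in `W(D_m)` for `m` even, an automorphism of the apartment normalising `W` for `m` odd). [cite: CartierCorvallis1979, §IV (4.2), Thm. 4.1]
[cite: Satake1963, §§6–9] [cite: Laumon1995, (4.1.4)–(4.1.6)] [cite: Macdonald1995, Ch. V (2.6)–(2.7)] -/
theorem coeff_satakeTransform_neg_of_units_orthogonal (hd : UnramifiedLocalConjDatum (RingHom.id K) ϖ) (u : Rˣ)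
    (hu : (u : R) ^ 2 = Nat.card 𝓀[K]) (w : Multiplicative (Fin N → ℤ) →* R)
    (hw : ∀ e : Fin N → ℤ, w (Multiplicative.ofAdd e) =
      ((u ^ (-∑ p ∈ (Finset.univ : Finset (Fin N × Fin N)) with (p.1 < p.2 ∧ p.1 < Fin.rev p.2), (e p.1 - e p.2)) : Rˣ) : R))
    (T : heckeAlgebra R (unitaryGroupOfForm (RingHom.id K) ((StdForm.antidiagonal N).over K))
      (unitaryInt (RingHom.id K) ((StdForm.antidiagonal N).over K)))
    (μ : Fin N → ℤ) :
    ((hd.isIwasawaExponent (N := N)).satakeTransform w T).coeff (-μ) =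
      ((hd.isIwasawaExponent (N := N)).satakeTransform w T).coeff μ := by
  by_cases hμ : ∀ i, μ (Fin.rev i) = -μ i
  · have key := hd.coeff_satakeTransform_mul_relIndex_eq_unitary (R := R) w T hμ
    have hS := toNat_sum_filter_sub_toNat_sum_filter μ
    have hΛneg : ∑ p ∈ (Finset.univ : Finset (Fin N × Fin N)) with (p.1 < p.2 ∧ p.1 < Fin.rev p.2), ((-μ) p.1 - (-μ) p.2) =
        -∑ p ∈ (Finset.univ : Finset (Fin N × Fin N)) with (p.1 < p.2 ∧ p.1 < Fin.rev p.2), (μ p.1 - μ p.2) := by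
      rw [← Finset.sum_neg_distrib]
      exact Finset.sum_congr rfl fun p _ => by simp only [Pi.neg_apply]; ring
    have hw' : w (Multiplicative.ofAdd (-μ)) =
        ((u ^ (∑ p ∈ (Finset.univ : Finset (Fin N × Fin N)) with (p.1 < p.2 ∧ p.1 < Fin.rev p.2), (μ p.1 - μ p.2)) : Rˣ) : R) := by
      rw [hw, hΛneg, neg_neg]
    rw [hd.relIndex_borelInt_conjAct_eq_orthogonal hμ, hd.relIndex_conjAct_borelInt_eq_orthogonal hμ, hw', hw,
      Nat.cast_pow, Nat.cast_pow, ← hu, ← pow_mul, ← pow_mul] at key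
    set e := ∑ p ∈ (Finset.univ : Finset (Fin N × Fin N)) with (p.1 < p.2 ∧ p.1 < Fin.rev p.2), (μ p.1 - μ p.2).toNat with he
    set e' := ∑ p ∈ (Finset.univ : Finset (Fin N × Fin N)) with (p.1 < p.2 ∧ p.1 < Fin.rev p.2), (μ p.2 - μ p.1).toNat with he'
    set S := ∑ p ∈ (Finset.univ : Finset (Fin N × Fin N)) with (p.1 < p.2 ∧ p.1 < Fin.rev p.2), (μ p.1 - μ p.2) with hSdef
    rw [mul_assoc, mul_assoc, units_zpow_mul_pow_eq u (by omega : S + ((2 * e' : ℕ) : ℤ) = -S + ((2 * e : ℕ) : ℤ))] at key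
    exact ((IsUnit.mul_left_inj ((Units.isUnit _).mul ((Units.isUnit u).pow _))).1 key).symm
  · have hμ' : ¬ ∀ i, (-μ) (Fin.rev i) = -(-μ) i := fun h => hμ fun i => by
      have := h i; rw [Pi.neg_apply, Pi.neg_apply] at this; omega
    rw [hd.coeff_satakeTransform_eq_zero_of_not_rev _ T hμ, hd.coeff_satakeTransform_eq_zero_of_not_rev _ T hμ']

/-- **`ι(𝒮_w T) = 𝒮_w T`** over `R` for `O_N(J₀)` and every `N` (`ι(x^μ) = x^{-μ}`; orthogonal weight `u^{-Λ(·)}`, `u² = q`).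
[cite: CartierCorvallis1979, §IV Thm. 4.1] [cite: Satake1963, §§8–9] -/
theorem domCongr_neg_satakeTransform_of_units_orthogonal (hd : UnramifiedLocalConjDatum (RingHom.id K) ϖ) (u : Rˣ)
    (hu : (u : R) ^ 2 = Nat.card 𝓀[K]) (w : Multiplicative (Fin N → ℤ) →* R)
    (hw : ∀ e : Fin N → ℤ, w (Multiplicative.ofAdd e) =
      ((u ^ (-∑ p ∈ (Finset.univ : Finset (Fin N × Fin N)) with (p.1 < p.2 ∧ p.1 < Fin.rev p.2), (e p.1 - e p.2)) : Rˣ) : R))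
    (T : heckeAlgebra R (unitaryGroupOfForm (RingHom.id K) ((StdForm.antidiagonal N).over K))
      (unitaryInt (RingHom.id K) ((StdForm.antidiagonal N).over K))) :
    AddMonoidAlgebra.domCongr R R (AddEquiv.neg (Fin N → ℤ)) ((hd.isIwasawaExponent (N := N)).satakeTransform w T) =
      (hd.isIwasawaExponent (N := N)).satakeTransform w T := by
  refine AddMonoidAlgebra.ext (Finsupp.ext fun μ => ?_)
  rw [IsIwasawaExponent.coeff_domCongr_neg, hd.coeff_satakeTransform_neg_of_units_orthogonal u hu w hw]

/-- **`range 𝒮_w ⊆ R[Λ⁻]^{w₀}`** over `R` for `O_N(J₀)` and every `N`: every transform vanishes off the antisymmetric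
cocharacters and is even under `μ ↦ -μ`. [cite: CartierCorvallis1979, §IV Thm. 4.1] [cite: Satake1963, §§8–9] -/
theorem satakeTransform_mem_setOf_of_units_orthogonal (hd : UnramifiedLocalConjDatum (RingHom.id K) ϖ) (u : Rˣ)
    (hu : (u : R) ^ 2 = Nat.card 𝓀[K]) (w : Multiplicative (Fin N → ℤ) →* R)
    (hw : ∀ e : Fin N → ℤ, w (Multiplicative.ofAdd e) =
      ((u ^ (-∑ p ∈ (Finset.univ : Finset (Fin N × Fin N)) with (p.1 < p.2 ∧ p.1 < Fin.rev p.2), (e p.1 - e p.2)) : Rˣ) : R))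
    (T : heckeAlgebra R (unitaryGroupOfForm (RingHom.id K) ((StdForm.antidiagonal N).over K))
      (unitaryInt (RingHom.id K) ((StdForm.antidiagonal N).over K))) :
    (hd.isIwasawaExponent (N := N)).satakeTransform w T ∈
      {f : AddMonoidAlgebra R (Fin N → ℤ) | (∀ μ : Fin N → ℤ, (¬ ∀ i, μ (Fin.rev i) = -μ i) → f.coeff μ = 0) ∧
        ∀ μ : Fin N → ℤ, f.coeff (-μ) = f.coeff μ} :=
  ⟨fun _ hμ => hd.coeff_satakeTransform_eq_zero_of_not_rev _ T hμ,
    fun μ => hd.coeff_satakeTransform_neg_of_units_orthogonal u hu w hw T μ⟩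

end UnramifiedLocalConjDatum

/-! ## §4 The unitarily normalised transform at `σ = id` is twisted by `μ ↦ q^{∑_{i<i'} μ_i}` -/

omit [Valued K ℤᵐ⁰] in
/-- Reindexing: the antidiagonal positions `(i, i')`, `i < i'`, are parametrised by their row.
[cite: Laumon1995, (4.1.4)] -/
theorem sum_filter_eq_rev_eq_sum {M : Type*} [AddCommMonoid M] (f : Fin N → Fin N → M) :
    ∑ p ∈ (Finset.univ : Finset (Fin N × Fin N)) with (p.1 < p.2 ∧ p.2 = Fin.rev p.1), f p.1 p.2 =
      ∑ i ∈ (Finset.univ : Finset (Fin N)) with i < Fin.rev i, f i (Fin.rev i) := by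
  refine Finset.sum_nbij' (fun p => p.1) (fun i => (i, Fin.rev i)) (fun p hp => ?_) (fun i hi => ?_) (fun p hp => ?_)
    (fun i _ => rfl) (fun p hp => ?_)
  · simp only [Finset.mem_filter, Finset.mem_univ, true_and] at hp ⊢
    rw [← hp.2]
    exact hp.1
  · simp only [Finset.mem_filter, Finset.mem_univ, true_and] at hi ⊢
    exact ⟨hi, trivial⟩
  · simp only [Finset.mem_filter, Finset.mem_univ, true_and] at hp
    exact Prod.ext rfl hp.2.symm
  · simp only [Finset.mem_filter, Finset.mem_univ, true_and] at hp
    rw [hp.2]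

omit [Valued K ℤᵐ⁰] in
/-- **`∑_{i<j, j=i'} (μ_i - μ_j) = 2 ∑_{i<i'} μ_i`** for antisymmetric `μ`. [cite: Laumon1995, (4.1.4)] -/
theorem sum_filter_eq_rev_sub_eq_two_mul {μ : Fin N → ℤ} (hμ : ∀ i, μ (Fin.rev i) = -μ i) :
    ∑ p ∈ (Finset.univ : Finset (Fin N × Fin N)) with (p.1 < p.2 ∧ p.2 = Fin.rev p.1), (μ p.1 - μ p.2) =
      2 * ∑ i ∈ (Finset.univ : Finset (Fin N)) with i < Fin.rev i, μ i := by
  rw [sum_filter_eq_rev_eq_sum (fun i j => μ i - μ j), Finset.mul_sum]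
  exact Finset.sum_congr rfl fun i _ => by rw [hμ]; ring

namespace UnramifiedLocalConjDatum

variable [Finite 𝓀[K]]
  [IsHeckeTriple (⊤ : Submonoid (unitaryGroupOfForm (RingHom.id K) ((StdForm.antidiagonal N).over K)))
    (unitaryInt (RingHom.id K) ((StdForm.antidiagonal N).over K)) (unitaryInt (RingHom.id K) ((StdForm.antidiagonal N).over K))]

/-- **THE TREE'S `ℂ`-TRANSFORM AT `σ = id` IS TWISTED, NOT SYMMETRIC**: `hd.satakeTransform` carries the weight
`(√q)^{-⟨ν,·⟩}`, `2⟨ν, μ⟩ = ∑_{i<j} (μ_i - μ_j)`, the half-sum of the UNITARY group; for `σ = id` (the split orthogonal group,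
whose half-sum is `Λ/2`) and every antisymmetric `μ` one gets instead
**`𝒮(T)_{-μ} = (√q)^{∑_{i<j, j=i'} (μ_i - μ_j)} · 𝒮(T)_μ`** (g44-#3's weighted duality with the indices of §1: the two sides
differ by `(√q)^{2⟨ν,μ⟩ - 2Λ(μ)}`, and `2⟨ν,μ⟩ - 2Λ(μ)` is the antidiagonal sum by `two_mul_sum_add_sum_eq`).
[cite: CartierCorvallis1979, §IV (4.2), Thm. 4.1] [cite: Satake1963, §§8–9] [cite: Laumon1995, (4.1.4)–(4.1.6)] -/
theorem coeff_satakeTransform_neg_eq_zpow_mul_orthogonal (hd : UnramifiedLocalConjDatum (RingHom.id K) ϖ)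
    (T : heckeAlgebra ℂ (unitaryGroupOfForm (RingHom.id K) ((StdForm.antidiagonal N).over K))
      (unitaryInt (RingHom.id K) ((StdForm.antidiagonal N).over K)))
    {μ : Fin N → ℤ} (hμ : ∀ i, μ (Fin.rev i) = -μ i) :
    (hd.satakeTransform T).coeff (-μ) =
      residueCardSqrt K ^ (∑ p ∈ (Finset.univ : Finset (Fin N × Fin N)) with (p.1 < p.2 ∧ p.2 = Fin.rev p.1), (μ p.1 - μ p.2)) *
        (hd.satakeTransform T).coeff μ := by
  rw [hd.satakeTransform_eq_isIwasawaExponent_satakeTransform]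
  have hs : residueCardSqrt K ≠ 0 := residueCardSqrt_ne_zero
  have key := hd.coeff_satakeTransform_mul_relIndex_eq_unitary (R := ℂ)
    (satakeWeightHom (residueCardSqrt K) residueCardSqrt_ne_zero) T hμ
  have hS := toNat_sum_filter_sub_toNat_sum_filter μ
  have h2 := two_mul_sum_add_sum_eq hμ
  have h3 := sum_filter_lt_sub_eq_two_mul_satakeTwistExp μ hμ
  rw [hd.relIndex_borelInt_conjAct_eq_orthogonal hμ, hd.relIndex_conjAct_borelInt_eq_orthogonal hμ,
    natCast_card_residueField_pow, natCast_card_residueField_pow, satakeWeightHom_ofAdd,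
    satakeWeightHom_ofAdd, satakeWeight, satakeWeight, satakeTwistExp_neg, neg_neg, mul_assoc, mul_assoc, ← zpow_add₀ hs,
    ← zpow_add₀ hs] at key
  set e := ∑ p ∈ (Finset.univ : Finset (Fin N × Fin N)) with (p.1 < p.2 ∧ p.1 < Fin.rev p.2), (μ p.1 - μ p.2).toNat with he
  set e' := ∑ p ∈ (Finset.univ : Finset (Fin N × Fin N)) with (p.1 < p.2 ∧ p.1 < Fin.rev p.2), (μ p.2 - μ p.1).toNat with he'
  set S := ∑ p ∈ (Finset.univ : Finset (Fin N × Fin N)) with (p.1 < p.2 ∧ p.1 < Fin.rev p.2), (μ p.1 - μ p.2) with hSdef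
  set D := ∑ p ∈ (Finset.univ : Finset (Fin N × Fin N)) with (p.1 < p.2 ∧ p.2 = Fin.rev p.1), (μ p.1 - μ p.2) with hDdef
  set A := ((hd.isIwasawaExponent (N := N)).satakeTransform
    (satakeWeightHom (residueCardSqrt K) residueCardSqrt_ne_zero) T).coeff μ with hA
  set B := ((hd.isIwasawaExponent (N := N)).satakeTransform
    (satakeWeightHom (residueCardSqrt K) residueCardSqrt_ne_zero) T).coeff (-μ) with hB
  have hexp : satakeTwistExp μ + ((2 * e' : ℕ) : ℤ) = (-satakeTwistExp μ + ((2 * e : ℕ) : ℤ)) + D := by omega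
  rw [hexp, zpow_add₀ hs] at key
  have hX : residueCardSqrt K ^ (-satakeTwistExp μ + ((2 * e : ℕ) : ℤ)) ≠ 0 := zpow_ne_zero _ hs
  have key' : residueCardSqrt K ^ D * A * residueCardSqrt K ^ (-satakeTwistExp μ + ((2 * e : ℕ) : ℤ)) =
      B * residueCardSqrt K ^ (-satakeTwistExp μ + ((2 * e : ℕ) : ℤ)) := by
    rw [← key]; ring
  exact (mul_right_cancel₀ hX key').symm

/-- **`𝒮(T)_{-μ} = q^{∑_{i<i'} μ_i} · 𝒮(T)_μ`** for the tree's `ℂ`-valued transform at `σ = id` and every antisymmetric `μ`: the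
unitarily normalised Satake transform of the split orthogonal group is the orthogonally normalised (hence `w₀`-symmetric, §3)
one twisted by the unramified character `x^μ ↦ (√q)^{-∑_{i<i'} μ_i} x^μ`. [cite: CartierCorvallis1979, §IV (4.2), Thm. 4.1]
[cite: Satake1963, §§8–9] [cite: Laumon1995, (4.1.4)–(4.1.6)] -/
theorem coeff_satakeTransform_neg_eq_pow_card_mul_orthogonal (hd : UnramifiedLocalConjDatum (RingHom.id K) ϖ)
    (T : heckeAlgebra ℂ (unitaryGroupOfForm (RingHom.id K) ((StdForm.antidiagonal N).over K))
      (unitaryInt (RingHom.id K) ((StdForm.antidiagonal N).over K)))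
    {μ : Fin N → ℤ} (hμ : ∀ i, μ (Fin.rev i) = -μ i) :
    (hd.satakeTransform T).coeff (-μ) =
      (Nat.card 𝓀[K] : ℂ) ^ (∑ i ∈ (Finset.univ : Finset (Fin N)) with i < Fin.rev i, μ i) * (hd.satakeTransform T).coeff μ := by
  rw [hd.coeff_satakeTransform_neg_eq_zpow_mul_orthogonal T hμ, sum_filter_eq_rev_sub_eq_two_mul hμ, zpow_mul, zpow_ofNat,
    residueCardSqrt_sq]

end UnramifiedLocalConjDatum

/-! ## §5 The exponent is `⟨2ρ, μ⟩`: `Λ(μ) = ∑_{i<i'} (N-2-2i) μ_i` -/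

omit [Valued K ℤᵐ⁰] in
/-- Pairing `i ↔ i'`: a weight with `f(i') = f(i)` vanishing at a self-dual index sums to twice its sum over `i < i'`.
[cite: Laumon1995, (4.1.4)] -/
theorem sum_eq_two_mul_sum_filter_lt_rev (f : Fin N → ℤ) (hf : ∀ i, f (Fin.rev i) = f i)
    (hf0 : ∀ i, Fin.rev i = i → f i = 0) :
    ∑ i, f i = 2 * ∑ i ∈ (Finset.univ : Finset (Fin N)) with i < Fin.rev i, f i := by
  rw [← Finset.sum_filter_add_sum_filter_not Finset.univ (fun i => i < Fin.rev i), two_mul]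
  congr 1
  rw [← Finset.sum_filter_add_sum_filter_not (Finset.univ.filter fun i => ¬ i < Fin.rev i) (fun i => Fin.rev i < i)]
  have h0 : ∑ i ∈ ((Finset.univ : Finset (Fin N)).filter fun i => ¬ i < Fin.rev i).filter (fun i => ¬ Fin.rev i < i), f i = 0 :=
    Finset.sum_eq_zero fun i hi => by
      simp only [Finset.mem_filter, Finset.mem_univ, true_and, not_lt] at hi
      exact hf0 i (le_antisymm hi.1 hi.2)
  rw [h0, add_zero]
  refine Finset.sum_equiv Fin.revPerm (fun i => ?_) (fun i _ => ?_)
  · simp only [Finset.mem_filter, Finset.mem_univ, true_and, Fin.revPerm_apply, Fin.rev_rev, not_lt]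
    exact ⟨fun h => h.2, fun h => ⟨h.le, h⟩⟩
  · rw [Fin.revPerm_apply, hf]

omit [Valued K ℤᵐ⁰] in
/-- **`Λ(μ) = ∑_{i<j, i<j'} (μ_i - μ_j) = ∑_{i<i'} (N-2-2i) μ_i = ⟨2ρ, μ⟩`** for antisymmetric `μ`: for `N = 2m` the
coefficients `2(m-1-i)` (`i < m`) are those of `2ρ` of `D_m`, for `N = 2m+1` the coefficients `2(m-i)-1` are those of `2ρ`
of `B_m` (from `2Λ + ∑_{i<i'} 2μ_i = ∑_{i<j} (μ_i-μ_j) = ∑_i (N-1-2i) μ_i`, `two_mul_sum_add_sum_eq`, `sum_filter_lt_sub_eq`).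
[cite: Laumon1995, (4.1.4)–(4.1.6)] [cite: Satake1963, §§8–9] [cite: CartierCorvallis1979, §IV (4.2)] -/
theorem sum_filter_lt_rev_sub_eq_sum_mul {μ : Fin N → ℤ} (hμ : ∀ i, μ (Fin.rev i) = -μ i) :
    ∑ p ∈ (Finset.univ : Finset (Fin N × Fin N)) with (p.1 < p.2 ∧ p.1 < Fin.rev p.2), (μ p.1 - μ p.2) =
      ∑ i ∈ (Finset.univ : Finset (Fin N)) with i < Fin.rev i, ((N : ℤ) - 2 - 2 * (i : ℕ)) * μ i := by
  have h2 := two_mul_sum_add_sum_eq hμ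
  have h3 := sum_filter_lt_sub_eq μ
  have hD := sum_filter_eq_rev_sub_eq_two_mul hμ
  have hpair := sum_eq_two_mul_sum_filter_lt_rev (fun i => ((N : ℤ) - 1 - 2 * (i : ℕ)) * μ i)
    (fun i => by
      rw [hμ, Fin.val_rev, Nat.cast_sub i.is_lt]
      push_cast
      ring)
    (fun i hi => by
      have h := hμ i
      rw [hi] at h
      have h0 : μ i = 0 := by omega
      rw [h0, mul_zero])
  have hsum : ∑ i ∈ (Finset.univ : Finset (Fin N)) with i < Fin.rev i, ((N : ℤ) - 2 - 2 * (i : ℕ)) * μ i =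
      ∑ i ∈ (Finset.univ : Finset (Fin N)) with i < Fin.rev i, ((N : ℤ) - 1 - 2 * (i : ℕ)) * μ i -
        ∑ i ∈ (Finset.univ : Finset (Fin N)) with i < Fin.rev i, μ i := by
    rw [← Finset.sum_sub_distrib]
    exact Finset.sum_congr rfl fun i _ => by ring
  rw [hsum]
  omega

end Literature.NumberTheory.Automorphic.HermitianLattice
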